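import Mathlib
import HarnessLib
import Summits.HubbardSuperconductivity.HubbardSuperconductivity.Theses.ComplexGFFStiffness
import Summits.HubbardSuperconductivity.HubbardSuperconductivity.Theorems.ComplexGFFStiffnessHypACumulantSplitShrunk
import Summits.HubbardSuperconductivity.HubbardSuperconductivity.Theorems.ComplexGFFStiffnessTwoKernelSkBound
import Summits.HubbardSuperconductivity.HubbardSuperconductivity.Theorems.ComplexGFFStiffnessL2GaussianCore
import Summits.HubbardSuperconductivity.HubbardSuperconductivity.Theorems.ComplexGFFStiffnessF4StatementOfCores
import Summits.HubbardSuperconductivity.HubbardSuperconductivity.Theorems.ComplexGFFStiffnessH1bcStatement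
import Summits.HubbardSuperconductivity.HubbardSuperconductivity.Theorems.ComplexGFFStiffnessF1Residual

/-!
# Route `route-HubbardSuperconductivity-ComplexGFFStiffness`: the crux `HypACumulant` (stmt-HubbardSuperconductivity-19154) HOLDS

The glue `HypACumulant_of_subs` (p825920; item `HypACumulantGlue` closed) applied to the five re-typed children, all landed:
`TwoKernelSkBound_proof` (this generation), `L2GaussianCore_proof`, `F4StatementOfCores_proof`, `H1bcStatement_proof`, `F1Residual_proof`.
Statement: `∃ L₀, ∀ L odd ≥ L₀, ∃ g₀ C, 0 < g₀ ∧ CumulantBoundAt L g₀ C` — the volume-uniform cumulant (hypothesis (A), cumulant part)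
bound for the complex Gaussian gradient field `ComplexGradientGFF4` via the [ABKM19] renormalisation group.

* **`HypACumulant_proof`** — the route decl `Summit.….Theses.ComplexGFFStiffness.HypACumulant` BY NAME.

All proved, no `sorry`.  Honest scope: rung route H2gff / 1c (stiffness of a complex Gaussian gradient field); nothing about
superconductivity in the Hubbard model is claimed or advanced — the summit is NOT proved by this.

## References
* S. Adams, S. Buchholz, R. Kotecký, S. Müller, arXiv:1910.13564, Thm 2.2, Lemma 12.6 [AdamsBuchholzKoteckyMuller2019].
-/

noncomputable section

-- `Summit.<Summit>.<Problem>`: single-conjunct summit, the duplicate component is mandated (D-0017).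
set_option linter.dupNamespace false

namespace Summit.HubbardSuperconductivity.HubbardSuperconductivity.Theorems

/-- **The crux `HypACumulant` (stmt-HubbardSuperconductivity-19154) holds**, from the five re-typed children through the landed glue.
[cite: AdamsBuchholzKoteckyMuller2019, Thm 2.2 / Lemma 12.6] -/
theorem HypACumulant_proof :
    Summit.HubbardSuperconductivity.HubbardSuperconductivity.Theses.ComplexGFFStiffness.HypACumulant :=
  HypACumulant_of_subs TwoKernelSkBound_proof L2GaussianCore_proof F4StatementOfCores_proof H1bcStatement_proof
    F1Residual_proof

end Summit.HubbardSuperconductivity.HubbardSuperconductivity.Theorems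

end
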